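import Literature.NumberTheory.EllipticCurves.BSDSelmer
import HarnessLib

/-!
# BSD family — `p`-converse theorems for CM elliptic curves over `ℚ` (Burungale–Tian)

Named facts (sorry-free `def … : Prop`, D-0014) recording the two printed `p`-converse theorems to
Coates–Wiles / Gross–Zagier–Kolyvagin–Rubin for elliptic curves over `ℚ` **with complex
multiplication** — the "small image" sector in which the big-image `p`-converse theorems already
vendored in `BSDSelmer.lean` (bsd.S25: Skinner 2020, Burungale–Skinner–Tian–Wan 2024, Kim 2022;
all require `ρ̄_{E,p}` surjective or at least irreducible with big image) say nothing.

* `burungaleTian_analyticRank_eq_zero_of_selmerCorank_eq_zero_of_hasCM` — rank zero, ANY prime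
  `p` (Burungale–Tian, Ann. of Math. 203 (2026), Thm 1.1 = arXiv:2506.03465, p. 1).
* `burungaleTian_analyticRank_eq_one_of_selmerCorank_eq_one_of_hasCM` — rank one, `p > 3` of good
  ordinary reduction (Burungale–Tian, Invent. Math. 220 (2020), **Theorem 1.2**, p. 214, quoted
  verbatim in the docstring). The publisher's copy is paywalled (acquisition request acq-05805),
  but the author manuscript of the PUBLISHED version (Springer pagination 211–253, 43 pp.) is
  openly deposited in the NSF Public Access Repository, NSF-PAR id 10184490, and was read in full
  on 2026-08-17 (`lit read https://par.nsf.gov/servlets/purl/10184490`, text key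
  `paper:url-85381420cd53`): Theorem 1.2 (p. 214), its generalisation Theorem 4.4 (p. 248, CM
  abelian varieties of `GL₂`-type) and the complete proof (§4.2.3, pp. 249–250) are transcribed
  in the docstring from those pages. The statement — in particular the standing hypothesis
  `p > 3`, transcribed `5 ≤ p` — is moreover restated by four further held sources
  (Burungale–Castella–Skinner–Tian, Ann. Math. Qué. 46 (2022), §1; Kim, Math. Ann. 387 (2022),
  §1; Kriz, arXiv:2002.04767, §1; Burungale–Tian, J. Number Theory 230 (2022), Thm. 4.7). The
  transcription is the printed statement, not a weakening of it; its discharge `…_holds` is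
  apex-sized (review 2026-08-17, recorded in the docstring: the `Λ`-module and ideal-theoretic
  skeleton of the printed proof — §3.4 and §4.2.3 — is proved in the sibling
  `BSDSelmerCMPConverseHeegnerDescentProofs`, while every arithmetic INPUT of the printed proof is
  absent from the tree and from Mathlib; along ROUTE B — an auxiliary Heegner field, sibling
  `BSDSelmerCMPConverseHeegnerFieldProofs` — the fact is proved modulo the bsd.S25 cluster's leaves:
  `p_parity`, modularity, Hoffstein–Luo, Kato and one inline `K`-level leaf,
  Burungale–Castella–Grossi–Skinner 2026, Thm. 1 + Cor. 1).

Both facts ground the coranks `0` and `1` slice of the route item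
`Summit.BirchSwinnertonDyer.BirchSwinnertonDyer.Theses.SelmerRank.SelmerRankSmallImage`
(stmt-BirchSwinnertonDyer-14418) in its CM sub-sector (for a CM curve `ρ̄_{E,p}` is never
surjective for `p ≥ 3`); the item itself (all coranks, all non-surjective images) is open in print.

Vocabulary: `WeierstrassCurve.HasCM` (geometric CM, `Isogeny.lean`), `WeierstrassCurve.selmerCorank`
(`Selmer.lean`), `WeierstrassCurve.analyticRank` (`AnalyticRank.lean`),
`WeierstrassCurve.HasGoodReductionAtPrime` (`Tamagawa.lean`), `WeierstrassCurve.frobeniusTrace`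
(`GlobalMinimalModel.lean`, needs `[W.IsGloballyMinimal]`).

## Review of the rank-zero fact (2026-08-17, review-split seat, arXiv:2506.03465v2 open pp. 1–7)

OUTCOME: `burungaleTian_analyticRank_eq_zero_of_selmerCorank_eq_zero_of_hasCM` is correctly cut and
is in the source as printed — Thm. 1.1 (p. 1) with its clause "In particular, if `E` descends to
`ℚ`, then (1.1) holds" (`r = 0`) and the abstract ("Let `E` be a CM elliptic curve defined over `ℚ`
and `p` a prime"): every CM curve over `ℚ`, EVERY prime `p`, no reduction hypothesis — neither
mis-stated nor an open problem (published: Ann. of Math. (2) 203 (2026), no. 1,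
doi:10.4007/annals.2026.203.1.1), and not a restatement candidate.
Transcription checks: `W.HasCM` = geometric CM (for `E/ℚ` the endomorphisms are defined over the
CM field `K = K(j)`, so `E_K` has CM by an order of `K` and descends to `ℚ`, the case the clause
addresses); `W.selmerCorank p = 0 ⟺ Sel_{p^∞}(E/ℚ)` finite
(`finite_selmerGroupPInfty_iff_selmerCorank_eq_zero`, sibling `…Proofs`), i.e. `ℤ_p`-corank `0`;
`W.analyticRank = ord_{s=1}` of the entire continuation of `L(E/ℚ, s)` (exists: Deuring–Hecke /
modularity), insensitive to finitely many Euler factors (none vanishes at `s = 1`).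
NOT PROVABLE from Mathlib or this library at present (no `_holds`): the printed proof (pp. 3–6) is
Thm. 3.1 (`H¹_f(ℚ, V_{F_λ}(f)(k/2)) = 0 ⟹ ord_{s=k/2} L(s, f) = 0` for CM newforms of even weight,
any `p`) from Thm. 2.6 (the CM case of Kato's main conjecture, Astérisque 295 Conj. 12.10, in
`Λ ⊗ ℚ`: `ξ(H²(V_{F_λ}(f))) = ξ(H¹(V_{F_λ}(f))/Z(f))`), itself from Thm. 2.1 (Johnson-Leung–Kings
2011, §7.2: the equivariant main conjecture for imaginary quadratic fields up to `⊗ ℚ`, elliptic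
units `z ⊂ h¹`, building on Rubin 1991 and Huber–Kings 2003) transported to Beilinson–Kato elements
by Kato §15 (15.6, (15.16.1), Lemma 15.13, Prop. 15.17); Thm. 2.3 = Kato Thm. 12.4 (`H²(V)` torsion,
`H¹(V)` free of rank one over `Λ ⊗ ℚ`); Thm. 2.4 = Kato Thm. 12.5 (zeta elements `γ ↦ z_γ(f)`,
`H¹(V)/Z(f)` torsion); and inside the proof of Thm. 3.1: Kato's exact sequence (14.9.3), Tate's
Euler–Poincaré formula (14.9.5), localisation at `𝔮 = ker(Λ → O_λ, σ_c ↦ c^{-k/2})`, and Kato's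
explicit reciprocity law Thm. 12.5 (1) (`loc_p(z) ∉ H¹_f(ℚ_p, V(k/2)) ⟹ L(f, k/2) ≠ 0`); then
(p. 6) Deuring `L(s, E/K) = L(s, f) L(s, f̄)` and `Sel_{p^∞}(E/K)^∨ ⊗ K ≃ H¹_f(ℚ, V(f)) ⊕
H¹_f(ℚ, V(f̄))`. The tree has none of: Iwasawa cohomology `H^q(T) = lim H^q(ℤ[ζ_{p^n}, 1/p], T)` of
the Galois representation of a newform, Beilinson–Kato elements, Bloch–Kato `H¹_f` over `ℚ` and
`ℚ_p`, the explicit reciprocity law, elliptic units / the `ℤ_p⟦G_{p^∞𝔣}⟧`-modules `h¹, h²`, the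
Grössencharacter `ψ_{E/K}` and its CM newforms `f, f̄` (the tree's Deuring theorem
`Deuring_LFunction_baseChange_cmField` is deliberately Grössencharacter-free). What the tree DOES
have is orthogonal or partial:
the descent `K → ℚ` of p. 6 and the dictionary `corank 0 ⟺ Sel` finite are PROVED in
`BSDSelmerCMPConverseProofs` (the fact is equivalent, given modularity, to Thm. 1.1 over `K` for
curves descending to `ℚ`, hypothesis `hBT` there); the cyclotomic vocabulary (`IwasawaAlgebra`,
`SelmerDualData`, `charIdeal`, `padicLFunction`, Mazur's control theorem `selmer_control`, the
main-conjecture fact `burungale_castella_skinner_charIdeal_eq_padicLFunction`) lives at GOOD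
ORDINARY `p ≥ 5` and could at best reach that sector, never "any prime `p`" — half the primes are
supersingular for a CM curve, and the primes `p ∣ #𝓞_K^×` (so `p = 2`, always) are exactly what the
paper adds to Rubin 1991 (hypothesis (1.2) `p ∤ #𝓞_K^×` of the source, p. 1; its Thm. 1.2 is the
case `p = 2`). The older Rubin facts in the tree (`Rubin1987_*`, `shaFinite_of_hasCM_of_L_one_ne_zero`)
run in the opposite direction (`L(E,1) ≠ 0 ⟹` finiteness). Consumers keep taking
`(h : burungaleTian_analyticRank_eq_zero_of_selmerCorank_eq_zero_of_hasCM)`.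

## Review of the rank-one fact (2026-08-17, review-split seat, NSF-PAR 10184490 = pp. 211–253 open)

OUTCOME: `burungaleTian_analyticRank_eq_one_of_selmerCorank_eq_one_of_hasCM` is correctly cut and
is in the source as printed — it is Theorem 1.2 (p. 214) word for word ("Let `E` be a CM elliptic
curve over the rationals. Let `p > 3` be a good ordinary prime for the elliptic curve `E/ℚ`. Then,
`corank_{ℤ_p} Sel_{p^∞}(E/ℚ) = 1 ⟹ ord_{s=1} L(s, E/ℚ) = 1`"), hypotheses complete: neither
mis-stated nor an open problem (published and refereed, Invent. Math. 220 (2020); reproved by a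
different method — for CM by `O_K`, every good ordinary `p`, under an extra conductor
hypothesis — by Burungale–Castella–Skinner–Tian 2022, Thm. A: "For `p > 3`, this gives a new
proof of a theorem by Burungale–Tian [BT20]"), and not a restatement or a slice of another fact.
Transcription checks: `W.HasCM` = CM by an order of an imaginary quadratic field (p. 216);
`[W.IsGloballyMinimal]` only so that `W.frobeniusTrace p = p + 1 - #Ẽ(𝔽_p)` is the true `a_p`;
good ordinary at `p` = `W.HasGoodReductionAtPrime p ∧ ¬ p ∣ a_p` (p. 213: "From now, we suppose
that `p` is a good ordinary prime"); `5 ≤ p` = the printed `p > 3`; `W.selmerCorank p` = the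
`ℤ_p`-corank of `Sel_{p^∞}(E/ℚ)`; `W.analyticRank` = `ord_{s=1} L(s, E/ℚ)`.
NOT PROVABLE from Mathlib or this library at present (no `_holds`; the printed proof, §4.2.3, and
the inventory of what the tree has and lacks are in the fact's docstring): of the seven steps
Parity / Auxiliary twist / Self-dual pair / Gross–Zagier (Yuan–Zhang–Zhang) / Rubin's main
conjecture / Heegner main conjecture (Disegni's `Λ`-adic Gross–Zagier, Agboola–Howard, Arnold,
Burungale–Disegni) / Descent, only the abstract `Λ`-module Descent lemma is a theorem of the tree.
ROUTE B (2026-08-17, sibling `BSDSelmerCMPConverseHeegnerFieldProofs`): over an AUXILIARY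
imaginary quadratic field `K ≠ M` with the classical Heegner hypothesis — the architecture by
which the tree decomposes the big-image `p`-converses (`BSDSelmerPConverse`,
`BSDSelmerPConverseYanZhuProofs`) — the fact is PROVED modulo the existing named facts
`p_parity`, `ModularForms.exists_isNewformOf`, `HoffsteinLuo1997_exists_twist_L_one_ne_zero`,
`kato_finite_of_L_one_ne_zero` (or `rank_eq_analyticRank_of_analyticRank_le_one`) and ONE inline
published `K`-level leaf, Burungale–Castella–Grossi–Skinner, Camb. J. Math. 14 (2026), Thm. 1 +
Cor. 1, rank-one case as printed (hypothesis `hBCGS`, the same rendering as in the Yan–Zhu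
decomposition): `burungaleTian_analyticRank_eq_one_of_selmerCorank_eq_one_of_hasCM_of_bcgs`. Its
image hypotheses (irr) `E[p]` irreducible and (tor) `E(K)[p] = 0` are THEOREMS for CM curves at
good ordinary `p ≥ 5` (Serre, `hasIrreducibleModPGaloisRep_of_hasCM_of_five_le`;
`torsionBy_eq_bot_of_hasIrreducibleModPGaloisRep`). So the fact rests on the leaf set of the
bsd.S25 cluster. CONVERSELY (sibling `BSDSelmerCMPConverseKLevelProofs`, 2026-08-17): that `K`-level
leaf restricted to CM curves FOLLOWS from this fact, the rank-zero fact below and the continuation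
of `L(E, s)`, in the stronger form "every quadratic `K` unramified at `p` (`p ∤ d_K`), real or
imaginary, no Heegner, discriminant, torsion or image hypothesis"
(`analyticRankEK_eq_one_of_hasCM_of_selmerCorank_baseChange_eq_one_of_burungaleTian`: the corank
over `K` splits as `corank(E) + corank(E^{(d_K)})`, Dokchitser–Dokchitser Lemma 4.14, and the CM
twist `E^{(d_K)} ≅ E^{(m)}`, `d_K ∈ {m, 4m}`, is handled on a globally minimal model of `E^{(m)}`,
good ordinary at `p ∤ 2m`), so that modulo the cluster's common
leaves the fact is EQUIVALENT to the CM half of the leaf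
(`burungaleTian_analyticRank_eq_one_iff_bcgsCM_of_facts`): the CM half is not a smaller debt —
over CM curves the `K`-level and the `ℚ`-level corank-one `p`-converses are one theorem up to the
rank-zero `p`-converse — while the non-CM half alone carries the big-image corollaries
(`yanZhu_analyticRank_eq_one_of_selmerCorank_eq_one_of_bcgsNonCM`, through
`not_hasSurjectiveModNGaloisRep_of_hasCM_of_not_dvd_frobeniusTrace`: a CM curve has non-surjective
`ρ̄_{E,p}` at every good ordinary `p > 3`). KOLYVAGIN SYSTEM (2026-08-17, sibling
`BSDSelmerCMPConverseKolyvaginSystemProofs`): along the printed proof of BCGS Cor. 1 ("the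
non-vanishing of the Kolyvagin system in combination with [Kolyvagin 1991]", §0.1, p. 4) the CM
half of the leaf is in turn proved from the NAMED facts
`BurungaleEtAl2026_exists_kolyvaginClass_ne_zero` (BCGS Thm. 1 — the non-vanishing of the
Heegner-point Kolyvagin system, a theorem there — stated under (irr), (tor), hence applicable to
CM curves),
`analyticRankEK_eq_one_iff_heegner_nonTorsion` (Gross–Zagier; or `gross_zagier` + modularity) and
`heegnerPointOfConductor_one_galoisConj` (Shimura reciprocity at conductor `1`) and ONE inline
input, the formula of Cor. 1 itself, `ord(κ^{Heeg}) = max{r⁺, r⁻} − 1`, for CM curves — the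
structure step, which the tree has only under surjective `ρ̄_{E,p}`
(`Kolyvagin1991_selmerCorank_of_kolyvaginClass_ne_zero`, Kolyvagin's printed `ℓ ∈ B(E)`; Gross
1991, §2, assumes no CM), inapplicable to CM curves:
`burungaleTian_analyticRank_eq_one_of_selmerCorank_eq_one_of_hasCM_of_cor1CM_of_nekovar` (eight
named facts — Nekovář's parity theorem, modularity, Hoffstein–Luo, Coates–Wiles, Rubin 1987, BCGS
Thm. 1, Gross–Zagier, reciprocity — and that formula). A discharge therefore needs Burungale–Tian's
own inputs (route A) or a `K`-level theorem genuinely covering CM curves — after 2026-08-17: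
Kolyvagin's structure theorem (the Cor. 1 formula) for CM curves over an auxiliary Heegner field.
Consumers keep taking `(h : burungaleTian_analyticRank_eq_one_of_selmerCorank_eq_one_of_hasCM)`.
-/

open WeierstrassCurve

namespace Literature.NumberTheory.EllipticCurves

/-- **Burungale–Tian, rank zero `p`-converse** (A. A. Burungale, Y. Tian, *A rank zero
`p`-converse to a theorem of Gross–Zagier, Kolyvagin and Rubin*, Ann. of Math. (2) 203 (2026),
no. 1, 1–13 = arXiv:2506.03465, **Theorem 1.1**, p. 1). Printed statement: "Let `E` be an elliptic
curve defined over an imaginary quadratic field `K`, with complex multiplication by an order of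
`K`. Let `p` be a prime. Then `corank_{ℤ_p} Sel_{p^∞}(E/K) = 0 ⟹ ord_{s=1} L(s, E/K) = 0`. In
particular, if `E` descends to `ℚ`, then (1.1) holds", where (1.1) (p. 1) is
"`corank_{ℤ_p} Sel_{p^∞}(E/ℚ) = r ⟹ ord_{s=1} L(s, E/ℚ) = r`" (here with `r = 0`); abstract:
"Let `E` be a CM elliptic curve defined over `ℚ` and `p` a prime. We show that
`corank_{ℤ_p} Sel_{p^∞}(E/ℚ) = 0 ⟹ ord_{s=1} L(s, E/ℚ) = 0`."
Transcription (the `E/ℚ` form): `E` CM over `ℚ` = `W.HasCM` (geometric CM; every CM elliptic curve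
over `ℚ` has CM by an order of its CM field `K` and descends from `K` to `ℚ` tautologically);
`p` any prime; corank = `W.selmerCorank p`; conclusion `W.analyticRank = 0`.
Grounds the corank-`0`, CM slice of `Summit.BirchSwinnertonDyer.BirchSwinnertonDyer.Theses.SelmerRank.SelmerRankSmallImage`.
[cite: BurungaleTian2026, Thm. 1.1] -/
def burungaleTian_analyticRank_eq_zero_of_selmerCorank_eq_zero_of_hasCM : Prop :=
  ∀ (W : WeierstrassCurve ℚ) [W.IsElliptic] (_hCM : W.HasCM) (p : ℕ) [Fact p.Prime]
    (_h : W.selmerCorank p = 0), W.analyticRank = 0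

/-- **Burungale–Tian, rank one `p`-converse for CM curves** (A. A. Burungale, Y. Tian,
*`p`-converse to a theorem of Gross–Zagier, Kolyvagin and Rubin*, Invent. Math. 220 (2020), no. 1,
211–253, **Theorem 1.2**, p. 214). Source read in full (2026-08-17) from the author manuscript of
the published version deposited in the NSF Public Access Repository (NSF-PAR 10184490,
`lit read https://par.nsf.gov/servlets/purl/10184490`, text key `paper:url-85381420cd53`,
Springer pagination; the publisher's copy, doi:10.1007/s00222-019-00929-7, is acq-05805).
**Theorem 1.2, verbatim** (p. 214): "Let `E` be a CM elliptic curve over the rationals. Let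
`p > 3` be a good ordinary prime for the elliptic curve `E/ℚ`. Then,
`corank_{ℤ_p} Sel_{p^∞}(E/ℚ) = 1 ⟹ ord_{s=1} L(s, E/ℚ) = 1`. In particular, `rank_ℤ E(ℚ) = 1`
and `Ш(E/ℚ)` is finite whenever `corank_{ℤ_p} Sel_{p^∞}(E/ℚ) = 1`." It is followed by: "Note
that, 'In particular' part follows from the work of Gross–Zagier, Kolyvagin and Rubin. We would
like to emphasise that finiteness of the Tate–Shafarevich group `Ш(E/ℚ)` is not our hypothesis
but in fact a consequence. For CM elliptic curves, the `p`-converse under finiteness of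
`Ш(E/ℚ)[p^∞]` is indeed due to Rubin [40] around early 90's." Context (p. 213): "we refer to the
implication `corank_{ℤ_p} Sel_{p^∞}(E/ℚ) = r ⟹ ord_{s=1} L(s, E/ℚ) = r` as a `p`-converse
theorem. […] From now, we suppose that `p` is a good ordinary prime for `E/ℚ`"; p. 216: "let `E`
be a CM elliptic curve over the rationals with CM by an order in an imaginary quadratic field
`K`". Abstract (p. 211), first two sentences: "Let `E` be a CM elliptic curve over the rationals
and `p > 3` a good ordinary prime for `E`. We show that `corank_{ℤ_p} Sel_{p^∞}(E/ℚ) = 1` implies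
`ord_{s=1} L(s, E/ℚ) = 1` for the `p^∞`-Selmer group `Sel_{p^∞}(E/ℚ)` and the complex
`L`-function `L(s, E/ℚ)`. In particular, the Tate–Shafarevich group `Ш(E/ℚ)` is finite whenever
`corank_{ℤ_p} Sel_{p^∞}(E/ℚ) = 1`."
**General form** (Theorem 4.4, p. 248, "The main result of the article"; Theorem 1.2 is its case
`E_f = ℚ`, `A = E`): "Let `f ∈ S₂(Γ₀(N))` be an elliptic CM modular form of weight two, trivial
neben-type with complex multiplication by an imaginary quadratic field. Let `E_f` be the
corresponding Hecke field with integer ring `O_{E_f}`. Let `A/ℚ` be a corresponding `GL₂`-type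
abelian variety with `O_{E_f} ⊂ End(A)`. Let `p > 3` be a good ordinary prime for `A`, `℘` a
prime above `p` in `E_f` determined via the embedding `ι_p` and `O` the completion of `O_{E_f}`
at `℘`. Then, `corank_{O_℘} Sel_{℘^∞}(A/ℚ) = 1 ⟹ ord_{s=1} L(s, A) = [E_f : ℚ]`." (Theorem 4.4
is not vendored: the tree has no `GL₂`-type / CM-newform dictionary; see the TODO below.)
**Printed proof** (§4.2.3 "Proof of the main result", pp. 249–250, of Thm. 4.4; `K` the CM field,
in which `p` splits as `f` is `p`-ordinary; bracketed numbers are the paper's references):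
*Parity* — `λ` the self-dual arithmetic Hecke character over `K` of infinity type `(1, 0)` attached
to `f`; "As `corank_{O_℘} Sel_{℘^∞}(A/ℚ) = 1`, we deduce `ε(1/2, λ) = -1` (4.2) from the parity
conjecture due to Nekovář [31, Thm. A']". *Auxiliary twist* — Prop. 4.2 (from Rohrlich [36,
p. 384], [11, Lem. 2.5] and [21, Lem. 5.31]): a finite order Hecke character `χ` over `K` with
`p ∤ cond^r(χ)` and `L(1, λ* · χ/χ*) ≠ 0` (4.3). *Self-dual pair* — `g` the CM form of `λχ⁻¹`;
"`L(s, g × χ) = L(s, λ) · L(s, λ* · χ/χ*)` […] By (4.3), we thus have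
`ord_{s=1} L(s, λ) = 1 ⟺ ord_{s=1} L(s, g × χ) = 1`"; the pair `(g, χ)` satisfies the Heegner
hypotheses (H) of §2.1 by (4.2) and (4.3). *Gross–Zagier* — "In view of the Gross–Zagier formula
due to Yuan–Zhang–Zhang [49, Thm. 1.2], it thus follows that `ord_{s=1} L(s, λ) = 1 ⟺ P_{g,χ} ≠ 0`"
for the Heegner point `P_{g,χ} ∈ B(K)_ℚ` on the abelian variety `B/K` of the pair (Def. 2.1).
*Heegner main conjecture* — Rubin [38, Thm. 11.1]: `L(1, λ* · χ/χ*) ≠ 0 ⟹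
corank H¹_f(K, L(λ* · χ/χ*)) = 0` (4.4), whence `corank_L (Sel_{p^∞}(B/K) ⊗ L) = 1` by the Selmer
decomposition Lemma 3.7; and Thm. 3.2 (ii), `Char_Λ S(B)/(κ) · Char_Λ (S(B)/(κ))^ι =
Char_Λ X(B)_tor` (4.5) with `rank_Λ X(B) = 1` (Prop. 3.9) — proved in §3 from Disegni's `Λ`-adic
Gross–Zagier formula [18], the anticyclotomic CM main conjectures of Agboola–Howard [2], Arnold
[3] and Rubin [38, 39] (elliptic units), the non-vanishing of the anticyclotomic regulator [7],
[2, App.] and the `Λ`-non-torsionness of the Heegner class `κ` (Mazur's conjecture) [11].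
*Descent* — "`X(B)/I · X(B) → Sel_{p^∞}(B/K)^∨ ⊗ L` (4.6) with finite kernel and cokernel"
(control, from [3, Prop. 4.3] via Lemma 3.7); "As `corank_L (Sel_{p^∞}(B/K) ⊗ L) = 1`, we first
note that `X(B)/I · X(B)` is not a torsion `L`-module (4.6). In view of HMC (4.5), it now follows
that the Heegner cohomology class corresponding to the Heegner point `P_{g,χ}` is non-trivial.
This finishes the proof."
**Status of the discharge** (review 2026-08-17): apex-sized. What the printed proof DOES with
its inputs is a theorem of the tree: the sibling `BSDSelmerCMPConverseHeegnerDescentProofs` proves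
the `Λ`-module and ideal-theoretic skeleton of §3.4 (HMC (ii) from the `GL₁` main conjectures,
Disegni's formula, Cor. 3.16, Cor. 3.8 and the regulator, by ideal arithmetic:
`BurungaleTian2019.charIdeal_mul_conj_eq_of_gl1MainConjectures`), of Lemma 3.7 / Cor. 3.8 /
Prop. 3.9, and of the *Descent* of §4.2.3 in the shape used here (rank-one `X(B)` with its torsion
submodule, (4.5) in its `ι`-product rational form, for every coefficient ring `𝒪` by restriction
of scalars: `IwasawaAlgebra.pow_smul_specialization_ne_zero_of_hmc`,
`IwasawaAlgebra.pow_smul_specialization_ne_zero_of_hmc_of_coefficients`), ending in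
`BurungaleTian2019.analyticRank_eq_one_of_skeleton` (the conclusion `W.analyticRank = 1` for one
curve from abstract skeleton data and the single arithmetic implication "the Heegner class is
non-torsion ⟹ `ord_{s=1} L(s, g × χ) = 1`"); the parity input exists as the named fact
`selmerCorank_mod_two_eq` / `p_parity` (over `ℚ`). The INPUTS do not exist: the Hecke
character `λ` of `E` and its `L`-function, the CM forms `θ(λ)`, `g`, the Shimura-curve abelian
variety `B/K` and Heegner point `P_{g,χ}` of Yuan–Zhang–Zhang, the anticyclotomic `Λ`-adic Selmer
groups `S(B)`, `X(B)`, Katz `p`-adic `L`-functions, Bloch–Kato Selmer groups of Hecke characters,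
Rubin's main conjecture and Disegni's formula exist neither in the tree nor in Mathlib as
theorems. The fact therefore stays a cited hypothesis; nothing weaker or stronger is vendored.
**Route B** (2026-08-17, sibling `BSDSelmerCMPConverseHeegnerFieldProofs`): over an AUXILIARY
imaginary quadratic field `K ≠ M` satisfying the classical Heegner hypothesis for `N_E` (the
architecture of the tree's decompositions of the big-image `p`-converses, Yan–Zhu, proof of
Thm. 4.15, §4.6), the fact is PROVED modulo the existing named facts `p_parity` (sign
`w(E) = -1`), `ModularForms.exists_isNewformOf` (Artin factorisation
`ord L(E/K) = ord L(E) + ord L(E^{(d_K)})` and the sign of the twists),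
`HoffsteinLuo1997_exists_twist_L_one_ne_zero` (the field: every `ℓ ∣ N_E` split, `p` split,
`d_K ≡ 1 (mod 8)`, `L(E^{(d_K)}, 1) ≠ 0`), `kato_finite_of_L_one_ne_zero` (corank `0` for the
twist; or `rank_eq_analyticRank_of_analyticRank_le_one`) and ONE inline `K`-level leaf printed for
EVERY `E/ℚ` — Burungale–Castella–Grossi–Skinner, *Non-vanishing of Kolyvagin systems and Iwasawa
theory*, Camb. J. Math. 14 (2026), Thm. 1 + Cor. 1, rank-one case (`p > 3` good ordinary, (irr)
`E[p]` irreducible, (Heeg), (disc), (tor) `E(K)[p] = 0`, `p` split in `K`: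
`corank_{ℤ_p} Sel_{p^∞}(E/K) = 1 ⟹ ord_{s=1} L(E/K, s) = 1`; their rational anticyclotomic main
conjecture being Burungale–Castella–Skinner, IMRN 2025, Thm. 1.2.2 (a)), hypothesis `hBCGS` in
the identical rendering of `yanZhu_analyticRank_eq_one_of_selmerCorank_eq_one_of_bcgs`:
`burungaleTian_analyticRank_eq_one_of_selmerCorank_eq_one_of_hasCM_of_bcgs` (and
`…_of_rank_eq_analyticRank`, `…_of_exists_isNewformOf`). For a CM curve at a good ordinary `p ≥ 5`
the image hypotheses of that leaf are theorems: (irr) is Serre's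
(`hasIrreducibleModPGaloisRep_of_hasCM_of_five_le`) and (tor) follows from (irr) for every
quadratic `K` (`torsionBy_eq_bot_of_hasIrreducibleModPGaloisRep`, proved there). The same file
re-runs the `K`-level descent "rational Heegner point main conjecture ⟹ `y_K` non-torsion ⟹
`ord_{s=1} L(E/K, s) = 1`" off Howard's big-image locus
(`analyticRankEK_eq_one_of_heegner_specialization_of_finrank`), the receiving end of
Burungale–Castella–Skinner's Thm. 1.2.2 (a) for CM curves. Along route B the fact is no longer
an apex leaf: it rests on the leaf set of the bsd.S25 cluster. Since 2026-08-17 the CM half of that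
leaf is in turn reduced (sibling `BSDSelmerCMPConverseKolyvaginSystemProofs`) to BCGS Thm. 1,
Gross–Zagier and reciprocity at conductor `1` — named facts
(`BurungaleEtAl2026_exists_kolyvaginClass_ne_zero`, `analyticRankEK_eq_one_iff_heegner_nonTorsion`,
`heegnerPointOfConductor_one_galoisConj`) — and the formula of BCGS Cor. 1,
`ord(κ^{Heeg}) = max{r⁺, r⁻} − 1`, for CM curves (inline: the structure step, in the tree only
under surjective `ρ̄_{E,p}`, `Kolyvagin1991_selmerCorank_of_kolyvaginClass_ne_zero`).
Restatements (held): Burungale–Castella–Skinner–Tian, Ann. Math. Qué. 46 (2022), §1 and Thm. A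
(authors' version, `web.math.ucsb.edu/~castella/CM.pdf`, p. 2: "For primes `p > 3`, the result
was first obtained by Burungale–Tian [BT20]"; their Thm. A — CM by `O_K`, every good ordinary
`p` — carries an extra conductor hypothesis and "(The same hypothesis is not present in [BT20],
thanks to the `p`-adic Gross–Zagier proved by Disegni [Dis17] in the generality of
Yuan–Zhang–Zhang [YZZ13].)"); C.-H. Kim, Math. Ann. 387 (2022),
§1 ("[Burungale–Tian] when `E` has CM and `p > 3` is good ordinary for `E`"); D. Kriz,
arXiv:2002.04767, §1 ("the ordinary CM case was treated when `p ≥ 5`"); Burungale–Tian, J. Number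
Theory 230 (2022), Thm. 4.7; Burungale–Tian, Ann. of Math. 203 (2026), §1 ("recently proved [3]
for CM elliptic curves in the rank one case for primes `p` of good ordinary reduction");
zbMATH Zbl 1452.11068.
Transcription: `W` a globally minimal model (needed to read `a_p`); `W.HasCM` (geometric CM, i.e.
CM by an order of an imaginary quadratic field, p. 216); `5 ≤ p`, i.e. the printed `p > 3`; good
reduction at `p` and `p ∤ a_p(E)` (good ordinary, p. 213); `W.selmerCorank p = 1`; conclusion
`W.analyticRank = 1` — Theorem 1.2 itself, hypotheses complete (the Lean statement is unchanged
since it was vendored, D-0014).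
Grounds the corank-`1`, CM slice of `Summit.BirchSwinnertonDyer.BirchSwinnertonDyer.Theses.SelmerRank.SelmerRankSmallImage`.
Theorem 1.2's "In particular" (finiteness of `Ш(E/ℚ)`, with `rank E(ℚ) = 1`), the last step of
the printed proof in the tree's vocabulary (parity and `L'(E, 1) ≠ 0`) and Kim's diagram (1.1)
(the converse to Gross–Zagier–Kolyvagin for every `E/ℚ` granted `#Ш[p^∞] < ∞`, from this fact
and Kim's Cor. 1.4) are proved from this fact in the sibling `BSDSelmerCMPConverseRankOneProofs`.
Restated with hypotheses in [cite: BurungaleCastellaSkinnerTian2022, §1 and Thm. A],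
[cite: Kim2022, §1], [cite: Kriz2020, §1], [cite: BurungaleTian2022Goldfeld, Thm. 4.7].
[cite: BurungaleTian2019, Thm. 1.2 (p. 214); proof §4.2.3 (pp. 249–250) via Thm. 4.4 (p. 248)] -/
def burungaleTian_analyticRank_eq_one_of_selmerCorank_eq_one_of_hasCM : Prop :=
  ∀ (W : WeierstrassCurve ℚ) [W.IsElliptic] [W.IsGloballyMinimal] (_hCM : W.HasCM) (p : ℕ)
    [Fact p.Prime] (_hp : 5 ≤ p) (_hgood : W.HasGoodReductionAtPrime p)
    (_hord : ¬ (p : ℤ) ∣ W.frobeniusTrace p) (_h : W.selmerCorank p = 1), W.analyticRank = 1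
-- TODO(general form): Burungale–Tian 2020, Thm. 4.4 (p. 248) — the same `p`-converse for the
-- `GL₂`-type CM abelian varieties `A_f/ℚ`, `f ∈ S₂(Γ₀(N))` a CM newform, with conclusion
-- `ord_{s=1} L(s, A) = [E_f : ℚ]`; needs a CM-newform / `GL₂`-type vocabulary the tree lacks.

end Literature.NumberTheory.EllipticCurves
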